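import Literature.AlgebraicGeometry.Resolution.WeightedBlowupNoIncrease
import Literature.AlgebraicGeometry.Resolution.WeightedBlowupMonomialStallIff

/-!
# The transplanted invariant `inv^coord` never increases at a point over the origin

Statement-level setting of `WeightedBlowupShade` (coordinate centres, the cobordant transform, points of
the exceptional divisor over the origin); everything here is DERIVED (elementary, proved in this file),
no published theorem is asserted as a fact. The observatory `pub-rosobs` recorded `inv_incr = 0` at
every point of every table (PATTERNS C13 / C18, CLAIMS G3-3); this file proves it in general:

* §1 `ATW.TruncLex`: transitivity, trichotomy, a counting criterion for `lt` between sorted lists, and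
  "inserting an entry into a sorted list makes it `TruncLex`-smaller".
* §2 `WeightedBlowup.exps γ` = the sorted exponent list of a cocharacter (`centreInvariant q γ = q :: exps γ`),
  its counting function, and the exceptional variable: `exps` over `Option σ` is `exps` over `σ` with
  `(γ none)⁻¹` inserted.
* §3 **Strict quasi-concavity** (`exps_lt_mix_or`): for nonnegative `γ₁ ≠ γ₂` and `0 < t < 1` the sorted
  exponent list of `(1-t)γ₁ + tγ₂` is `TruncLex`-larger than that of `γ₁` or that of `γ₂`. Hence the
  maximal admissible coordinate centre is unique, and (**initial-form invariance**, `not_lt_exps_of_face`)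
  it is also maximal among the nonnegative cocharacters satisfying only the constraints of the FACE
  monomials (`v_γ(d) = 1`).
* §4 Every monomial of the cobordant transform survives translation to a point over the origin and
  cleaning (`coeff_pointPolynomial_cobordantExponent`, `cobordantExponent_mem_support_newResidual`), the
  face monomials carry no power of `s`, and therefore (`not_truncLex_lt_of_isInvCoord_newResidual`,
  `not_invCoordIncreases`) **`¬ InvCoordIncreases q w ℓ b F`**: for `F` cleaned, `γ ≥ 0` the
  `TruncLex`-maximal admissible cocharacter (the transplanted centre FW2), `wᵢ = ℓγᵢ`, `ℓ > 0`, and any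
  point `b` over the origin (`b none = 0`, `bᵢ = 0` off the centre), in every characteristic, exponent
  `q` and dimension, with no equimultiplicity hypothesis.

References for the setting only: [AbramovichTemkinWlodarczyk2024] Abramovich–Temkin–Włodarczyk, §5.1
(the order, "inv = maximal invariant of an admissible center", Thm. 14); [AbramovichQuekSchober2025]
Def. 4.1, 4.5 (reduced centre, proper transform on `B`).
-/

open MvPolynomial Finset

open scoped BigOperators

namespace Literature.AlgebraicGeometry.Resolution

open Literature.AlgebraicGeometry.Resolution.Hauser2010

noncomputable section

/-! ## 1. The truncated-lex order -/

namespace ATW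

variable {α : Type*} [LinearOrder α]

omit [LinearOrder α] in
/-- `[]` is the `TruncLex`-maximum. [cite: AbramovichTemkinWlodarczyk2024, §5.1 (order of invariants)] -/
@[simp] theorem TruncLex.not_nil_lt [LT α] (b : List α) : ¬ TruncLex.lt [] b := by
  cases b <;> simp [TruncLex.lt]

omit [LinearOrder α] in
/-- A non-empty list is below its truncation `[]`. [cite: AbramovichTemkinWlodarczyk2024, §5.1 (order of invariants)] -/
@[simp] theorem TruncLex.cons_lt_nil [LT α] (x : α) (xs : List α) : TruncLex.lt (x :: xs) [] := by
  simp [TruncLex.lt]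

omit [LinearOrder α] in
/-- Head comparison. [cite: AbramovichTemkinWlodarczyk2024, §5.1 (order of invariants)] -/
theorem TruncLex.cons_lt_cons [LT α] {x y : α} {xs ys : List α} :
    TruncLex.lt (x :: xs) (y :: ys) ↔ x < y ∨ (x = y ∧ TruncLex.lt xs ys) := by
  simp [TruncLex.lt]

/-- `TruncLex.lt` is irreflexive. [folklore] -/
theorem TruncLex.lt_irrefl (a : List α) : ¬ TruncLex.lt a a := by
  induction a with
  | nil => simp
  | cons x xs ih => simp [TruncLex.cons_lt_cons, ih]

/-- `TruncLex.lt` is transitive. [folklore] -/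
theorem TruncLex.lt_trans {a b c : List α} (h₁ : TruncLex.lt a b) (h₂ : TruncLex.lt b c) :
    TruncLex.lt a c := by
  induction a generalizing b c with
  | nil => simp at h₁
  | cons x xs ih =>
    cases b with
    | nil => simp at h₂
    | cons y ys =>
      cases c with
      | nil => simp
      | cons z zs =>
        rw [TruncLex.cons_lt_cons] at h₁ h₂ ⊢
        rcases h₁ with h₁ | ⟨rfl, h₁⟩ <;> rcases h₂ with h₂ | ⟨rfl, h₂⟩
        · exact Or.inl (h₁.trans h₂)
        · exact Or.inl h₁
        · exact Or.inl h₂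
        · exact Or.inr ⟨rfl, ih h₁ h₂⟩

/-- `TruncLex.lt` is trichotomous. [folklore] -/
theorem TruncLex.trichotomous (a b : List α) : TruncLex.lt a b ∨ a = b ∨ TruncLex.lt b a := by
  induction a generalizing b with
  | nil => cases b <;> simp
  | cons x xs ih =>
    cases b with
    | nil => simp
    | cons y ys =>
      rw [TruncLex.cons_lt_cons, TruncLex.cons_lt_cons]
      rcases lt_trichotomy x y with h | rfl | h
      · exact Or.inl (Or.inl h)
      · rcases ih ys with h | rfl | h
        · exact Or.inl (Or.inr ⟨rfl, h⟩)
        · exact Or.inr (Or.inl rfl)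
        · exact Or.inr (Or.inr (Or.inr ⟨rfl, h⟩))
      · exact Or.inr (Or.inr (Or.inl h))

/-- **Counting criterion.** For sorted lists: if `A` and `B` have equally many entries `≤ θ` for every
`θ < θ₀` and `A` has MORE entries `≤ θ₀`, then `A` is `TruncLex`-smaller. [folklore] -/
theorem TruncLex.lt_of_countP (A B : List α) (hA : A.Pairwise (· ≤ ·)) (hB : B.Pairwise (· ≤ ·)) (θ₀ : α)
    (h1 : ∀ θ < θ₀, A.countP (fun x => decide (x ≤ θ)) = B.countP (fun x => decide (x ≤ θ)))
    (h2 : B.countP (fun x => decide (x ≤ θ₀)) < A.countP (fun x => decide (x ≤ θ₀))) :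
    TruncLex.lt A B := by
  induction A generalizing B with
  | nil => simp at h2
  | cons a A' ih =>
    cases B with
    | nil => simp
    | cons b B' =>
      rw [List.pairwise_cons] at hA hB
      rw [TruncLex.cons_lt_cons]
      rcases lt_trichotomy a b with hab | rfl | hab
      · exact Or.inl hab
      · refine Or.inr ⟨rfl, ih B' hA.2 hB.2 ?_ ?_⟩
        · intro θ hθ
          have := h1 θ hθ
          simp only [List.countP_cons, decide_eq_true_eq] at this
          omega
        · simp only [List.countP_cons, decide_eq_true_eq] at h2
          omega
      · exfalso
        have hA0 : ∀ θ, θ < a → (a :: A').countP (fun x => decide (x ≤ θ)) = 0 := by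
          intro θ hθ
          rw [List.countP_eq_zero]
          intro x hx
          simp only [decide_eq_true_eq, not_le]
          rcases List.mem_cons.mp hx with rfl | hx
          · exact hθ
          · exact lt_of_lt_of_le hθ (hA.1 x hx)
        by_cases hb : b < θ₀
        · have := h1 b hb
          rw [hA0 b hab] at this
          simp at this
        · push Not at hb
          rw [hA0 θ₀ (lt_of_le_of_lt hb hab)] at h2
          exact absurd h2 (Nat.not_lt_zero _)

/-- Prepending an entry below all others makes a sorted list `TruncLex`-smaller. [folklore] -/
theorem TruncLex.cons_lt_of_forall_le (b : α) (l : List α) (h : ∀ c ∈ l, b ≤ c) :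
    TruncLex.lt (b :: l) l := by
  induction l generalizing b with
  | nil => simp
  | cons c l' ih =>
    rw [TruncLex.cons_lt_cons]
    rcases lt_or_eq_of_le (h c (by simp)) with hlt | rfl
    · exact Or.inl hlt
    · exact Or.inr ⟨rfl, ih b fun x hx => h x (by simp [hx])⟩

/-- **Inserting an entry into a sorted list makes it `TruncLex`-smaller.** [folklore] -/
theorem TruncLex.orderedInsert_lt (x : α) (l : List α) (hl : l.Pairwise (· ≤ ·)) :
    TruncLex.lt (l.orderedInsert (· ≤ ·) x) l := by
  induction l with
  | nil => simp
  | cons c l' ih =>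
    rw [List.pairwise_cons] at hl
    simp only [List.orderedInsert]
    split_ifs with hxc
    · rw [TruncLex.cons_lt_cons]
      rcases lt_or_eq_of_le hxc with hlt | rfl
      · exact Or.inl hlt
      · exact Or.inr ⟨rfl, TruncLex.cons_lt_of_forall_le x l' hl.1⟩
    · rw [TruncLex.cons_lt_cons]
      exact Or.inr ⟨rfl, ih hl.2⟩

end ATW

/-! ## 2. Sorted exponent lists of cocharacters -/

namespace WeightedBlowup

section Exps

variable {σ : Type*} [Fintype σ]

/-- The sorted list of the centre exponents `(γ i)⁻¹`, `γ i ≠ 0`; `centreInvariant q γ = q :: exps γ`.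
[cite: AbramovichQuekSchober2025, Thm. 3.5 (lex-max over admissible centers)] -/
def exps (γ : σ → ℚ) : List ℚ :=
  ((Finset.univ.filter fun i => γ i ≠ 0).toList.map fun i => (γ i)⁻¹).insertionSort (· ≤ ·)

/-- `centreInvariant q γ = q :: exps γ`. [folklore] -/
theorem centreInvariant_eq (q : ℕ) (γ : σ → ℚ) : centreInvariant q γ = (q : ℚ) :: exps γ := rfl

/-- `exps γ` is sorted. [folklore] -/
theorem exps_sorted (γ : σ → ℚ) : (exps γ).Pairwise (· ≤ ·) :=
  List.pairwise_insertionSort _ _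

/-- Counting entries of a `Finset.toList`. [folklore] -/
theorem countP_toList {ι : Type*} (s : Finset ι) (p : ι → Prop) [DecidablePred p] :
    s.toList.countP (fun i => decide (p i)) = (s.filter p).card := by
  classical
  rw [← Multiset.coe_countP, Finset.coe_toList, Multiset.countP_eq_card_filter, ← Finset.filter_val,
    Finset.card_val]

/-- **The counting function of `exps γ`**: the number of entries `≤ θ` is the number of indices with
`γ i ≠ 0` and `(γ i)⁻¹ ≤ θ`. [folklore] -/
theorem countP_exps [DecidableEq σ] (γ : σ → ℚ) (θ : ℚ) :
    (exps γ).countP (fun x => decide (x ≤ θ)) =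
      (Finset.univ.filter fun i => γ i ≠ 0 ∧ (γ i)⁻¹ ≤ θ).card := by
  classical
  unfold exps
  rw [(List.perm_insertionSort _ _).countP_eq, List.countP_map]
  have : ((fun x : ℚ => decide (x ≤ θ)) ∘ fun i : σ => (γ i)⁻¹) = fun i => decide ((γ i)⁻¹ ≤ θ) := by
    funext i; rfl
  rw [this, countP_toList, Finset.filter_filter]

/-- Head and centre entries agree: `TruncLex.lt` on `centreInvariant`s is `TruncLex.lt` on `exps`. [folklore] -/
theorem centreInvariant_lt_iff (q : ℕ) (γ γ' : σ → ℚ) :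
    ATW.TruncLex.lt (centreInvariant q γ) (centreInvariant q γ') ↔ ATW.TruncLex.lt (exps γ) (exps γ') := by
  rw [centreInvariant_eq, centreInvariant_eq, ATW.TruncLex.cons_lt_cons]
  simp

/-- **The exceptional variable.** Over `Option σ`, `exps γ₁` is `exps (γ₁ ∘ some)` with the entry
`(γ₁ none)⁻¹` inserted (when `γ₁ none ≠ 0`). [folklore] -/
theorem exps_option [DecidableEq σ] (γ₁ : Option σ → ℚ) :
    exps γ₁ = if γ₁ none = 0 then exps (fun i => γ₁ (some i))
      else (exps (fun i => γ₁ (some i))).orderedInsert (· ≤ ·) (γ₁ none)⁻¹ := by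
  classical
  -- the index lists, up to permutation
  set P : Option σ → Prop := fun o => γ₁ o ≠ 0 with hP
  set lσ : List σ := (Finset.univ.filter fun i => γ₁ (some i) ≠ 0).toList with hlσ
  have hnd : (lσ.map some).Nodup :=
    (Finset.nodup_toList _).map (Option.some_injective σ)
  have hnotin : none ∉ lσ.map some := by simp
  have key : ∀ l₂ : List (Option σ), l₂.Nodup → l₂.toFinset = (Finset.univ.filter P) →
      exps γ₁ = (l₂.map fun o => (γ₁ o)⁻¹).insertionSort (· ≤ ·) := by
    intro l₂ hl₂ hfin
    unfold exps
    have hp : ((Finset.univ.filter P).toList.map fun o => (γ₁ o)⁻¹).Perm (l₂.map fun o => (γ₁ o)⁻¹) := by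
      apply List.Perm.map
      apply List.perm_of_nodup_nodup_toFinset_eq (Finset.nodup_toList _) hl₂
      rw [Finset.toList_toFinset, hfin]
    exact (((List.perm_insertionSort _ _).trans hp).trans (List.perm_insertionSort _ _).symm).eq_of_sortedLE
      List.sortedLE_insertionSort List.sortedLE_insertionSort
  split_ifs with h0
  · rw [key (lσ.map some) hnd ?_]
    · unfold exps; rw [List.map_map]; rfl
    · ext o; cases o <;> simp [hP, hlσ, h0]
  · rw [key (none :: lσ.map some) (List.nodup_cons.mpr ⟨hnotin, hnd⟩) ?_]
    · unfold exps
      rw [List.map_cons, List.insertionSort_cons, List.map_map]; rfl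
    · ext o; cases o <;> simp [hP, hlσ, h0]

end Exps

/-! ## 3. Strict quasi-concavity of the sorted exponent list, and initial-form invariance -/

section Quasi

variable {σ : Type*} [Fintype σ] [DecidableEq σ]

/-- "heavy" indices: for `θ > 0` and `x ≥ 0`, `x ≠ 0 ∧ x⁻¹ ≤ θ ↔ θ⁻¹ ≤ x`. [folklore] -/
theorem heavy_iff {x θ : ℚ} (hθ : 0 < θ) (hx : 0 ≤ x) : (x ≠ 0 ∧ x⁻¹ ≤ θ) ↔ θ⁻¹ ≤ x := by
  constructor
  · rintro ⟨hne, hle⟩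
    have hxpos : 0 < x := lt_of_le_of_ne hx (Ne.symm hne)
    exact (inv_le_comm₀ hxpos hθ).mp hle
  · intro h
    have hxpos : 0 < x := lt_of_lt_of_le (inv_pos.mpr hθ) h
    exact ⟨hxpos.ne', (inv_le_comm₀ hxpos hθ).mpr h⟩

/-- No index is heavy for a threshold `θ ≤ 0`. [folklore] -/
theorem not_heavy_of_nonpos {x θ : ℚ} (hθ : θ ≤ 0) (hx : 0 ≤ x) : ¬ (x ≠ 0 ∧ x⁻¹ ≤ θ) := by
  rintro ⟨hne, hle⟩
  have hxpos : 0 < x := lt_of_le_of_ne hx (Ne.symm hne)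
  have : (0 : ℚ) < x⁻¹ := inv_pos.mpr hxpos
  linarith

/-- One half of strict quasi-concavity (the asymmetric core). [folklore] -/
theorem exps_lt_mix_aux (γ₁ γ₂ : σ → ℚ) (h₁ : ∀ i, 0 ≤ γ₁ i) (h₂ : ∀ i, 0 ≤ γ₂ i)
    (t : ℚ) (ht0 : 0 < t) (ht1 : t < 1) (i₀ : σ) (hi₀ : γ₂ i₀ < γ₁ i₀)
    (hmin : ∀ i, γ₁ i ≠ γ₂ i → max (γ₁ i) (γ₂ i) ≤ γ₁ i₀) :
    ATW.TruncLex.lt (exps γ₁) (exps fun i => (1 - t) * γ₁ i + t * γ₂ i) := by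
  set μ : σ → ℚ := fun i => (1 - t) * γ₁ i + t * γ₂ i with hμ
  have hμnn : ∀ i, 0 ≤ μ i := fun i => by
    have := h₁ i; have := h₂ i; simp only [hμ]; nlinarith
  have hμeq : ∀ i, γ₁ i = γ₂ i → μ i = γ₁ i := fun i h => by simp only [hμ, ← h]; ring
  have hμlt : ∀ i, γ₁ i ≠ γ₂ i → μ i < max (γ₁ i) (γ₂ i) := by
    intro i hne
    rcases lt_or_gt_of_ne hne with h | h
    · rw [max_eq_right h.le]; simp only [hμ]; nlinarith
    · rw [max_eq_left h.le]; simp only [hμ]; nlinarith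
  have hpos : 0 < γ₁ i₀ := lt_of_le_of_lt (h₂ i₀) hi₀
  set θ₀ : ℚ := (γ₁ i₀)⁻¹ with hθ₀
  have hθ₀pos : 0 < θ₀ := inv_pos.mpr hpos
  apply ATW.TruncLex.lt_of_countP _ _ (exps_sorted _) (exps_sorted _) θ₀
  · -- below θ₀ the heavy sets coincide
    intro θ hθ
    rw [countP_exps, countP_exps]
    congr 1
    apply Finset.filter_congr
    intro i _
    by_cases hne : γ₁ i = γ₂ i
    · rw [hμeq i hne]
    · by_cases hθpos : 0 < θ
      · rw [heavy_iff hθpos (h₁ i), heavy_iff hθpos (hμnn i)]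
        have hlt : γ₁ i₀ < θ⁻¹ := by
          have := (inv_lt_inv₀ hθ₀pos hθpos).mpr hθ
          rwa [hθ₀, inv_inv] at this
        have hm := hmin i hne
        constructor
        · intro h; exfalso
          have : γ₁ i ≤ max (γ₁ i) (γ₂ i) := le_max_left _ _
          linarith
        · intro h; exfalso
          have := hμlt i hne
          linarith
      · push Not at hθpos
        simp [not_heavy_of_nonpos hθpos (h₁ i), not_heavy_of_nonpos hθpos (hμnn i)]
  · -- at θ₀ the mixed set is strictly smaller: it misses i₀
    rw [countP_exps, countP_exps]
    apply Finset.card_lt_card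
    rw [Finset.ssubset_iff_of_subset]
    · refine ⟨i₀, ?_, ?_⟩
      · simp only [Finset.mem_filter, Finset.mem_univ, true_and]
        exact ⟨hpos.ne', by rw [hθ₀]⟩
      · simp only [Finset.mem_filter, Finset.mem_univ, true_and]
        rw [heavy_iff hθ₀pos (hμnn i₀), hθ₀, inv_inv]
        have := hμlt i₀ (ne_of_gt hi₀)
        rw [max_eq_left hi₀.le] at this
        exact not_le.mpr this
    · intro i hi
      simp only [Finset.mem_filter, Finset.mem_univ, true_and] at hi ⊢
      by_cases hne : γ₁ i = γ₂ i
      · rwa [hμeq i hne] at hi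
      · exfalso
        rw [heavy_iff hθ₀pos (hμnn i), hθ₀, inv_inv] at hi
        have := hμlt i hne
        have := hmin i hne
        linarith

/-- **Strict quasi-concavity of `exps` for the truncated-lex order**: for nonnegative `γ₁ ≠ γ₂` and
`0 < t < 1`, `exps ((1-t)γ₁ + tγ₂)` is `TruncLex`-larger than `exps γ₁` or than `exps γ₂`. Consequently
a `TruncLex`-maximal cocharacter on a convex set is unique. (derived here) [folklore] -/
theorem exps_lt_mix_or (γ₁ γ₂ : σ → ℚ) (h₁ : ∀ i, 0 ≤ γ₁ i) (h₂ : ∀ i, 0 ≤ γ₂ i) (hne : γ₁ ≠ γ₂)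
    (t : ℚ) (ht0 : 0 < t) (ht1 : t < 1) :
    ATW.TruncLex.lt (exps γ₁) (exps fun i => (1 - t) * γ₁ i + t * γ₂ i) ∨
      ATW.TruncLex.lt (exps γ₂) (exps fun i => (1 - t) * γ₁ i + t * γ₂ i) := by
  classical
  set D : Finset σ := Finset.univ.filter fun i => γ₁ i ≠ γ₂ i with hD
  have hDne : D.Nonempty := by
    by_contra h
    rw [Finset.not_nonempty_iff_eq_empty] at h
    apply hne; funext i
    by_contra hi
    have : i ∈ D := by simp [hD, hi]
    rw [h] at this; simp at this
  -- the index where the two differ with the LARGEST weight (smallest exponent)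
  obtain ⟨i₀, hi₀D, hi₀max⟩ := Finset.exists_max_image D (fun i => max (γ₁ i) (γ₂ i)) hDne
  have hne₀ : γ₁ i₀ ≠ γ₂ i₀ := by simpa [hD] using hi₀D
  have hmin' : ∀ i, γ₁ i ≠ γ₂ i → max (γ₁ i) (γ₂ i) ≤ max (γ₁ i₀) (γ₂ i₀) :=
    fun i hi => hi₀max i (by simpa [hD] using hi)
  rcases lt_or_gt_of_ne hne₀ with hlt | hlt
  · right
    have hswap : (fun i => (1 - t) * γ₁ i + t * γ₂ i) = fun i => (1 - (1 - t)) * γ₂ i + (1 - t) * γ₁ i := by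
      funext i; ring
    rw [hswap]
    refine exps_lt_mix_aux γ₂ γ₁ h₂ h₁ (1 - t) (by linarith) (by linarith) i₀ hlt ?_
    intro i hi
    rw [max_comm, ← max_eq_right hlt.le]
    exact hmin' i (Ne.symm hi)
  · left
    refine exps_lt_mix_aux γ₁ γ₂ h₁ h₂ t ht0 ht1 i₀ hlt ?_
    intro i hi
    rw [← max_eq_left hlt.le]
    exact hmin' i hi

variable {K : Type*} [CommRing K]

omit [DecidableEq σ] in
/-- The monomial valuation is linear in the cocharacter. [folklore] -/
theorem monomialValuation_mix (γ₁ γ₂ : σ → ℚ) (a c : ℚ) (d : σ →₀ ℕ) :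
    monomialValuation (fun i => a * γ₁ i + c * γ₂ i) d =
      a * monomialValuation γ₁ d + c * monomialValuation γ₂ d := by
  unfold monomialValuation
  rw [Finsupp.sum_fintype _ _ (fun i => by simp), Finsupp.sum_fintype _ _ (fun i => by simp),
    Finsupp.sum_fintype _ _ (fun i => by simp), Finset.mul_sum, Finset.mul_sum, ← Finset.sum_add_distrib]
  exact Finset.sum_congr rfl fun i _ => by ring

omit [DecidableEq σ] in
/-- The monomial valuation of a nonnegative cocharacter is nonnegative. [folklore] -/
theorem monomialValuation_nonneg (γ : σ → ℚ) (hγ : ∀ i, 0 ≤ γ i) (d : σ →₀ ℕ) :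
    0 ≤ monomialValuation γ d := by
  unfold monomialValuation
  rw [Finsupp.sum_fintype _ _ (fun i => by simp)]
  exact Finset.sum_nonneg fun i _ => mul_nonneg (by positivity) (hγ i)

omit [Fintype σ] [DecidableEq σ] in
/-- A uniform mixing parameter: `0 < t < 1` with `(1 - t)·v ≥ 1` for every value `v > 1` of a finite
family. [folklore] -/
theorem exists_mix_param (s : Finset (σ →₀ ℕ)) (v : (σ →₀ ℕ) → ℚ) :
    ∃ t : ℚ, 0 < t ∧ t < 1 ∧ ∀ d ∈ s, 1 < v d → 1 ≤ (1 - t) * v d := by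
  classical
  set g : (σ →₀ ℕ) → ℚ := fun d => if 1 < v d then (v d - 1) / v d else 1 / 2 with hg
  have hg0 : ∀ d, 0 < g d := fun d => by
    simp only [hg]; split_ifs with h
    · exact div_pos (by linarith) (by linarith)
    · norm_num
  have hg1 : ∀ d, g d ≤ 1 := fun d => by
    simp only [hg]; split_ifs with h
    · rw [div_le_one (by linarith)]; linarith
    · norm_num
  refine ⟨(1 / 2) * ∏ d ∈ s, g d, mul_pos (by norm_num) (Finset.prod_pos fun d _ => hg0 d), ?_, ?_⟩
  · have : ∏ d ∈ s, g d ≤ 1 := Finset.prod_le_one (fun d _ => (hg0 d).le) (fun d _ => hg1 d)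
    linarith
  · intro d hd hvd
    have hprod : ∏ e ∈ s, g e ≤ g d := by
      rw [← Finset.mul_prod_erase s g hd]
      have : ∏ e ∈ s.erase d, g e ≤ 1 := Finset.prod_le_one (fun e _ => (hg0 e).le) (fun e _ => hg1 e)
      have := hg0 d
      nlinarith
    have hgd : g d = (v d - 1) / v d := by simp [hg, hvd]
    have hvpos : 0 < v d := by linarith
    have ht : (1 / 2) * ∏ e ∈ s, g e ≤ (v d - 1) / v d := by
      have := hg0 d; rw [hgd] at hprod this; nlinarith
    -- (1 - t)·v ≥ (1 - (v-1)/v)·v = 1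
    have key : (1 - (v d - 1) / v d) * v d = 1 := by field_simp; ring
    nlinarith [key, hvpos, ht]

/-- **Initial-form invariance (Lemma FACE).** If `γ ≥ 0` is admissible for `F` and `TruncLex`-maximal
among the nonnegative admissible cocharacters, then it is also maximal among the nonnegative
cocharacters that satisfy only the constraints of the FACE monomials `v_γ(d) = 1`:
`¬ exps γ <_TL exps γ'`. Proof: mix `γ' ` into `γ` with a small parameter (admissible), and apply strict
quasi-concavity. (derived here) [folklore] -/
theorem not_lt_exps_of_face (F : MvPolynomial σ K) (γ : σ → ℚ) (hγ0 : ∀ i, 0 ≤ γ i)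
    (hadm : IsAdmissibleFor γ F)
    (hmax : ∀ γ' : σ → ℚ, (∀ i, 0 ≤ γ' i) → IsAdmissibleFor γ' F →
      ¬ ATW.TruncLex.lt (exps γ) (exps γ'))
    (γ' : σ → ℚ) (hγ'0 : ∀ i, 0 ≤ γ' i)
    (hface : ∀ d ∈ F.support, monomialValuation γ d = 1 → 1 ≤ monomialValuation γ' d) :
    ¬ ATW.TruncLex.lt (exps γ) (exps γ') := by
  classical
  by_cases hne : γ = γ'
  · subst hne; exact ATW.TruncLex.lt_irrefl _
  obtain ⟨t, ht0, ht1, ht⟩ := exists_mix_param F.support (monomialValuation γ)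
  set μ : σ → ℚ := fun i => (1 - t) * γ i + t * γ' i with hμ
  have hμ0 : ∀ i, 0 ≤ μ i := fun i => by
    have := hγ0 i; have := hγ'0 i; simp only [hμ]; nlinarith
  have hμadm : IsAdmissibleFor μ F := by
    intro d hd
    rw [hμ, monomialValuation_mix]
    have h1 := hadm d hd
    have hnn := monomialValuation_nonneg γ' hγ'0 d
    rcases lt_or_eq_of_le h1 with hgt | heq
    · have := ht d hd hgt; nlinarith
    · have := hface d hd heq.symm; rw [← heq]; nlinarith
  have hnot := hmax μ hμ0 hμadm
  rcases exps_lt_mix_or γ γ' hγ0 hγ'0 hne t ht0 ht1 with h | h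
  · exact absurd h hnot
  · intro hlt
    exact hnot (ATW.TruncLex.lt_trans hlt h)

/-- **Uniqueness of the transplanted centre (Corollary Q1).** Two nonnegative admissible cocharacters
that are both `TruncLex`-maximal among the nonnegative admissible ones are equal — the observatory's
`n_tied_centres = 0` in every table is a theorem. (derived here) [folklore] -/
theorem eq_of_both_max (F : MvPolynomial σ K) (γ₁ γ₂ : σ → ℚ) (h₁ : ∀ i, 0 ≤ γ₁ i) (h₂ : ∀ i, 0 ≤ γ₂ i)
    (hadm₁ : IsAdmissibleFor γ₁ F) (hadm₂ : IsAdmissibleFor γ₂ F)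
    (hmax₁ : ∀ γ' : σ → ℚ, (∀ i, 0 ≤ γ' i) → IsAdmissibleFor γ' F →
      ¬ ATW.TruncLex.lt (exps γ₁) (exps γ'))
    (hmax₂ : ∀ γ' : σ → ℚ, (∀ i, 0 ≤ γ' i) → IsAdmissibleFor γ' F →
      ¬ ATW.TruncLex.lt (exps γ₂) (exps γ')) : γ₁ = γ₂ := by
  by_contra hne
  set μ : σ → ℚ := fun i => (1 - 1 / 2) * γ₁ i + 1 / 2 * γ₂ i with hμ
  have hμ0 : ∀ i, 0 ≤ μ i := fun i => by
    have := h₁ i; have := h₂ i; simp only [hμ]; nlinarith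
  have hμadm : IsAdmissibleFor μ F := by
    intro d hd
    rw [hμ, monomialValuation_mix]
    have := hadm₁ d hd; have := hadm₂ d hd
    nlinarith
  rcases exps_lt_mix_or γ₁ γ₂ h₁ h₂ hne (1 / 2) (by norm_num) (by norm_num) with h | h
  · exact hmax₁ μ hμ0 hμadm h
  · exact hmax₂ μ hμ0 hμadm h

end Quasi

/-! ## 4. Every monomial of the cobordant transform survives; the invariant never increases -/

section Main

variable {σ : Type*} {K : Type*} [CommRing K] [Fintype σ] [DecidableEq σ]

omit [DecidableEq σ] in
/-- A face monomial (`v_γ(d) = 1`) has weighted degree exactly `ℓ`: no power of `s` in the cobordant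
transform. [folklore] -/
theorem weightedDegree_eq_of_valuation_eq_one (γ : σ → ℚ) (w : σ → ℕ) (ℓ : ℕ) (d : σ →₀ ℕ)
    (hv : monomialValuation γ d = 1) (hw : ∀ i, (w i : ℚ) = ℓ * γ i) : ∑ i, w i * d i = ℓ := by
  have hval : monomialValuation γ d = ∑ i, (d i : ℚ) * γ i := by
    unfold monomialValuation
    rw [Finsupp.sum_fintype _ _ (fun i => by simp)]
  have h : ((∑ i, w i * d i : ℕ) : ℚ) = ℓ := by
    push_cast
    simp_rw [hw]
    rw [hval] at hv
    calc ∑ i, (ℓ : ℚ) * γ i * (d i : ℚ) = ℓ * ∑ i, (d i : ℚ) * γ i := by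
            rw [Finset.mul_sum]; exact Finset.sum_congr rfl fun i _ => by ring
      _ = ℓ := by rw [hv, mul_one]
  exact_mod_cast h

omit [DecidableEq σ] in
/-- The valuation of a cobordant exponent splits into its `s`-part and its `u`-part. [folklore] -/
theorem monomialValuation_cobordantExponent (γ₁ : Option σ → ℚ) (w : σ → ℕ) (ℓ : ℕ) (d : σ →₀ ℕ) :
    monomialValuation γ₁ (cobordantExponent w ℓ d) =
      (((∑ i, w i * d i) - ℓ : ℕ) : ℚ) * γ₁ none + monomialValuation (fun i => γ₁ (some i)) d := by
  classical
  unfold monomialValuation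
  rw [Finsupp.sum_fintype _ _ (fun i => by simp), Finsupp.sum_fintype _ _ (fun i => by simp),
    Fintype.sum_option, cobordantExponent_none]
  congr 1
  exact Finset.sum_congr rfl fun i _ => by rw [cobordantExponent_some]

/-- **Every monomial of `F` survives in the cobordant transform translated to a point over the origin,
with its coefficient** (`b none = 0`, `bᵢ = 0` wherever `wᵢ = 0`; admissibility makes the `s`-exponents
honest differences). (derived here) [folklore] -/
theorem coeff_pointPolynomial_cobordantExponent (γ : σ → ℚ) (w : σ → ℕ) (ℓ : ℕ)
    (b : Option σ → K) (F : MvPolynomial σ K) (d : σ →₀ ℕ)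
    (hadm : IsAdmissibleFor γ F) (hw : ∀ i, (w i : ℚ) = ℓ * γ i) (hℓ : 0 < ℓ)
    (hb0 : b none = 0) (hbS : ∀ i, γ i = 0 → b (some i) = 0) (hd : d ∈ F.support) :
    coeff (cobordantExponent w ℓ d) (pointPolynomial w ℓ b F) = coeff d F := by
  classical
  have hℓd : ℓ ≤ ∑ i, w i * d i := le_weightedDegree_of_admissible γ w ℓ d (hadm d hd) hw
  unfold pointPolynomial cobordantTransform
  unfold PointBlowup.translate
  rw [map_sum, coeff_sum]
  change ∑ x ∈ F.support, coeff (cobordantExponent w ℓ d)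
      (PointBlowup.translate b (monomial (cobordantExponent w ℓ x) (coeff x F))) = coeff d F
  rw [Finset.sum_eq_single d]
  · rw [coeff_translate_monomial_self]
  · intro β hβ hβd
    have hℓβ : ℓ ≤ ∑ i, w i * β i := le_weightedDegree_of_admissible γ w ℓ β (hadm β hβ) hw
    set E := cobordantExponent w ℓ β with hE
    set D := cobordantExponent w ℓ d with hD
    by_cases h1 : ∃ i, E i < D i
    · obtain ⟨i, hi⟩ := h1
      exact coeff_translate_monomial_eq_zero_of_lt b E D _ hi
    by_cases h2 : ∃ i, b i = 0 ∧ D i < E i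
    · obtain ⟨i, hbi, hi⟩ := h2
      exact coeff_translate_monomial_eq_zero_of_apply_eq_zero b E D _ hbi hi
    exfalso
    push Not at h1 h2
    have hle : ∀ i, d i ≤ β i := fun i => by
      have := h1 (some i)
      simpa only [hE, hD, cobordantExponent_some] using this
    have hnone : (∑ i, w i * β i) - ℓ ≤ (∑ i, w i * d i) - ℓ := by
      have := h2 none hb0
      simpa only [hE, hD, cobordantExponent_none] using this
    have hwβ : ∑ i, w i * β i ≤ ∑ i, w i * d i := by omega
    have hsum : ∑ i, w i * β i = ∑ i, w i * d i := by
      apply le_antisymm hwβ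
      exact Finset.sum_le_sum fun i _ => Nat.mul_le_mul_left _ (hle i)
    have hterm : ∀ i, w i * β i = w i * d i := by
      have hge : ∀ i ∈ (Finset.univ : Finset σ), w i * d i ≤ w i * β i :=
        fun i _ => Nat.mul_le_mul_left _ (hle i)
      intro i
      exact ((Finset.sum_eq_sum_iff_of_le hge).mp hsum.symm i (Finset.mem_univ i)).symm
    apply hβd
    ext i
    by_cases hwi : w i = 0
    · have hγi : γ i = 0 := by
        have := hw i
        rw [hwi, Nat.cast_zero] at this
        have hℓq : (ℓ : ℚ) ≠ 0 := by exact_mod_cast hℓ.ne'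
        exact (mul_eq_zero.mp this.symm).resolve_left hℓq
      have := h2 (some i) (hbS i hγi)
      simp only [hE, hD, cobordantExponent_some] at this
      exact le_antisymm this (hle i)
    · exact Nat.eq_of_mul_eq_mul_left (Nat.pos_of_ne_zero hwi) (hterm i)
  · intro h
    exact absurd hd h

/-- **… and survives the subtraction of the constant and the cleaning**: every cobordant exponent of a
monomial of the cleaned `F` is a monomial of the new residual. (derived here) [folklore] -/
theorem cobordantExponent_mem_support_newResidual (q : ℕ) (γ : σ → ℚ) (w : σ → ℕ) (ℓ : ℕ)
    (b : Option σ → K) (F : MvPolynomial σ K) (d : σ →₀ ℕ)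
    (hF : deletePthPowers q F = F) (hadm : IsAdmissibleFor γ F)
    (hw : ∀ i, (w i : ℚ) = ℓ * γ i) (hℓ : 0 < ℓ)
    (hb0 : b none = 0) (hbS : ∀ i, γ i = 0 → b (some i) = 0) (hd : d ∈ F.support) :
    cobordantExponent w ℓ d ∈ (newResidual q w ℓ b F).support := by
  classical
  have hdc : coeff d F ≠ 0 := by simpa [MvPolynomial.mem_support_iff] using hd
  have hnotp : ¬ IsPthPowerExponent q d := by
    intro hp
    apply hdc
    rw [← hF, coeff_deletePthPowers, if_pos hp]
  have hnotpD : ¬ IsPthPowerExponent q (cobordantExponent w ℓ d) := by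
    intro hp
    apply hnotp
    rw [isPthPowerExponent_iff] at hp ⊢
    intro i
    simpa [cobordantExponent_some] using hp (some i)
  have hDne : cobordantExponent w ℓ d ≠ 0 := by
    intro h
    apply hnotp
    rw [isPthPowerExponent_iff]
    intro i
    have := DFunLike.congr_fun h (some i)
    rw [cobordantExponent_some] at this
    simp [this]
  rw [MvPolynomial.mem_support_iff]
  unfold newResidual residual
  rw [coeff_deletePthPowers, if_neg hnotpD, coeff_sub, coeff_C, if_neg (Ne.symm hDne), sub_zero,
    coeff_pointPolynomial_cobordantExponent γ w ℓ b F d hadm hw hℓ hb0 hbS hd]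
  exact hdc

/-- **Main comparison.** Under the hypotheses of `not_secondEntryIncreases` and maximality of `γ`
(the transplanted centre), no value of the transplanted invariant of the new residual is
`TruncLex`-above `centreInvariant q γ`. (derived here: PATTERNS C13/C18, inv part, now proved) [folklore] -/
theorem not_truncLex_lt_of_isInvCoord_newResidual (q : ℕ) (γ : σ → ℚ) (w : σ → ℕ) (ℓ : ℕ)
    (b : Option σ → K) (F : MvPolynomial σ K)
    (hF : deletePthPowers q F = F) (hγ0 : ∀ i, 0 ≤ γ i) (hadm : IsAdmissibleFor γ F)
    (hmax : ∀ γ' : σ → ℚ, (∀ i, 0 ≤ γ' i) → IsAdmissibleFor γ' F →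
      ¬ ATW.TruncLex.lt (centreInvariant q γ) (centreInvariant q γ'))
    (hw : ∀ i, (w i : ℚ) = ℓ * γ i) (hℓ : 0 < ℓ)
    (hb0 : b none = 0) (hbS : ∀ i, γ i = 0 → b (some i) = 0)
    (v' : ATW.Invariant) (hv' : IsInvCoord q (newResidual q w ℓ b F) v') :
    ¬ ATW.TruncLex.lt (centreInvariant q γ) v' := by
  classical
  obtain ⟨⟨γ₁, hγ₁0, hγ₁adm, rfl⟩, -⟩ := hv'
  set γ₁' : σ → ℚ := fun i => γ₁ (some i) with hγ₁'
  -- the u-part of γ₁ satisfies the face constraints of F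
  have hface : ∀ d ∈ F.support, monomialValuation γ d = 1 → 1 ≤ monomialValuation γ₁' d := by
    intro d hd hv
    have hmem := cobordantExponent_mem_support_newResidual q γ w ℓ b F d hF hadm hw hℓ hb0 hbS hd
    have h1 := hγ₁adm _ hmem
    rw [monomialValuation_cobordantExponent, weightedDegree_eq_of_valuation_eq_one γ w ℓ d hv hw,
      Nat.sub_self, Nat.cast_zero, zero_mul, zero_add] at h1
    exact h1
  have hmax' : ∀ γ' : σ → ℚ, (∀ i, 0 ≤ γ' i) → IsAdmissibleFor γ' F →
      ¬ ATW.TruncLex.lt (exps γ) (exps γ') :=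
    fun γ' h0 h => (centreInvariant_lt_iff q γ γ').not.mp (hmax γ' h0 h)
  have key := not_lt_exps_of_face F γ hγ0 hadm hmax' γ₁' (fun i => hγ₁0 (some i)) hface
  rw [centreInvariant_eq, centreInvariant_eq, ATW.TruncLex.cons_lt_cons, exps_option]
  simp only [lt_self_iff_false, true_and, false_or]
  split_ifs with h0
  · exact key
  · intro hlt
    exact key (ATW.TruncLex.lt_trans hlt (ATW.TruncLex.orderedInsert_lt _ _ (exps_sorted _)))

/-- **Theorem INV (no weighted kangaroo for the transplanted invariant at points over the origin).**
For `F` cleaned of `q`-th powers, `γ ≥ 0` admissible and `TruncLex`-maximal among the nonnegative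
admissible cocharacters (the transplanted centre, FW2), weights `wᵢ = ℓγᵢ`, `ℓ > 0`, and a point `b` of
the exceptional divisor over the origin: `¬ InvCoordIncreases q w ℓ b F`.
(derived here: the observatory's PATTERNS C13 / C18, inv^coord part, now proved) [folklore] -/
theorem not_invCoordIncreases (q : ℕ) (γ : σ → ℚ) (w : σ → ℕ) (ℓ : ℕ)
    (b : Option σ → K) (F : MvPolynomial σ K)
    (hF : deletePthPowers q F = F) (hγ0 : ∀ i, 0 ≤ γ i) (hadm : IsAdmissibleFor γ F)
    (hmax : ∀ γ' : σ → ℚ, (∀ i, 0 ≤ γ' i) → IsAdmissibleFor γ' F →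
      ¬ ATW.TruncLex.lt (centreInvariant q γ) (centreInvariant q γ'))
    (hw : ∀ i, (w i : ℚ) = ℓ * γ i) (hℓ : 0 < ℓ)
    (hb0 : b none = 0) (hbS : ∀ i, γ i = 0 → b (some i) = 0) :
    ¬ InvCoordIncreases q w ℓ b F := by
  classical
  rintro ⟨v, v', hv, hv', hlt⟩
  rw [hF] at hv
  obtain ⟨⟨γ₀, hγ₀0, hγ₀adm, rfl⟩, hγ₀max⟩ := hv
  have e : centreInvariant q γ₀ = centreInvariant q γ := by
    rcases ATW.TruncLex.trichotomous (centreInvariant q γ₀) (centreInvariant q γ) with h | h | h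
    · exact absurd h (hγ₀max γ hγ0 hadm)
    · exact h
    · exact absurd h (hmax γ₀ hγ₀0 hγ₀adm)
  rw [e] at hlt
  exact not_truncLex_lt_of_isInvCoord_newResidual q γ w ℓ b F hF hγ0 hadm hmax hw hℓ hb0 hbS v' hv' hlt

end Main

end WeightedBlowup

end

end Literature.AlgebraicGeometry.Resolution
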